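import Literature.Analysis.FluidPDE.PassiveScalarDiagMildBounds
import Literature.Analysis.FluidPDE.PassiveScalarDiagMildCoeff
import HarnessLib

/-!
# Mild (Duhamel) formulation of the passive scalar equation with constant diagonal diffusion and
  bounded drift, VI: the Picard iteration and its fixed point

Analysis/FluidPDE proof-support file (everything proved). For the data `Torus.MildData` (horizon
`T > 0`, `κ > 0`, `aᵢ > 0`, drift bounded by `U`, `θ₀ ∈ L²`, damping `λ > 0` with
`(∑ⱼaⱼ⁻¹)U²/(2κλ) ≤ 1/4`) the Picard map `Φ(w)(t)(k) = e^{-(νₖ+λ)t}θ̂₀(k) - D^λ(w)(t)(k)` preserves the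
ball of radius `B = 2‖θ₀‖_{L²}` (`A + B/2 = B`) and contracts by `1/2` (the bound of
`PassiveScalarDiagMildBounds`); the iterates `cₙ₊₁ = Φ(wₙ)` (`wₙ` the synthesized field of `cₙ`)
satisfy `l2F(cₙ₊₁ - cₙ) ≤ B 2^{-(n+1)}`, converge uniformly on `[0,T]` coordinatewise and in the finite
`ℓ²` norms to an admissible family `c_∞`, whose synthesized field `w` is a **damped mild solution**
`𝓕(w(t))(k) = Φ(w)(t)(k)` on `[0,T]` (`MildData.exists_dampedMildSolution`; Pazy 1983, Ch. 6 Thm. 1.2).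

## References

* A. Pazy, *Semigroups of Linear Operators and Applications to PDE*, Springer 1983, Ch. 4 §4.2
  (mild solutions, (2.3), Def. 2.3), Ch. 6 §6.1 Thm. 1.2 (Picard iteration for the mild equation).
* R. J. DiPerna, P.-L. Lions, Invent. Math. 98 (1989) 511–547, §II.1. L. C. Evans, *PDE* (2010), §7.1.2.
* L. Grafakos, *Classical Fourier Analysis*, 3rd ed. (2014), Prop. 3.2.6 (4), (8), Prop. 3.2.7 (3), §3.3.1.
* J. C. Robinson, J. L. Rodrigo, W. Sadowski, *The Three-Dimensional Navier–Stokes Equations* (2016), Thm. 4.11.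
-/

noncomputable section

open MeasureTheory TopologicalSpace Set Function Filter UnitAddTorus
open _root_.Topology
open scoped ENNReal NNReal InnerProductSpace ComplexConjugate

namespace Literature.Analysis.FluidPDE

namespace Torus

open Literature.Analysis.FunctionSpaces.Torus Literature.Analysis.FunctionSpaces

variable {d : Type*} [Fintype d]

section Picard

namespace MildData

variable [DecidableEq d] [Nonempty d] (P : MildData d)


omit [DecidableEq d] [Nonempty d] in
/-- **The heat part is bounded by the datum**: `l2F F (e^{-(νₖ+λ)t} θ̂₀(k))ₖ ≤ A` for `t ≥ 0`
(`0 < e^{-(νₖ+λ)t} ≤ 1` and Bessel). [cite: Grafakos2014, Prop. 3.2.7 (3)] -/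
theorem l2F_heat_le {t : ℝ} (ht : 0 ≤ t) (F : Finset (d → ℤ)) :
    l2F F (fun k => ((Real.exp (-((diagRate P.κ P.a k + P.lam) * t)) : ℝ) : ℂ) *
      mFourierCoeff (fun x => (P.θ₀ x : ℂ)) k) ≤ P.A := by
  rw [A, l2F_apply]
  refine Real.sqrt_le_sqrt ((Finset.sum_le_sum fun k _ => ?_).trans
    (sum_le_hasSum F (fun _ _ => sq_nonneg _) (hasSum_sq_norm_mFourierCoeff_ofReal P.hθ₀)))
  rw [norm_mul, Complex.norm_real, Real.norm_of_nonneg (Real.exp_pos _).le, mul_pow]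
  have h1 : Real.exp (-((diagRate P.κ P.a k + P.lam) * t)) ≤ 1 := by
    rw [Real.exp_le_one_iff, neg_nonpos]
    exact mul_nonneg (add_nonneg (diagRate_nonneg P.hκ.le (fun i => (P.ha i).le) k) P.hlam.le) ht
  calc Real.exp (-((diagRate P.κ P.a k + P.lam) * t)) ^ 2 * ‖mFourierCoeff (fun x => (P.θ₀ x : ℂ)) k‖ ^ 2
      ≤ 1 ^ 2 * ‖mFourierCoeff (fun x => (P.θ₀ x : ℂ)) k‖ ^ 2 := by
        gcongr
    _ = ‖mFourierCoeff (fun x => (P.θ₀ x : ℂ)) k‖ ^ 2 := by rw [one_pow, one_mul]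

omit [DecidableEq d] [Nonempty d] in
/-- **The Duhamel part contracts by `1/2`**: for a field with `∫ w(t)² ≤ δ²` on `[0,T]`,
`l2F F (D^λ(w)(t)) ≤ δ/2` (the contraction bound `sum_norm_sq_duhamelCoeff_le_const` and `q ≤ 1/2`). [cite: Pazy1983, Ch. 6 §6.1 Thm. 1.2 (proof: Picard iteration), p. 184] -/
theorem l2F_duhamel_le {δ : ℝ} (hδ : 0 ≤ δ) {w : ℝ → UnitAddTorus d → ℝ} (hw : IsL2Field P.T (δ ^ 2) w)
    {t : ℝ} (ht : t ∈ Icc 0 P.T) (F : Finset (d → ℤ)) :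
    l2F F (duhamelCoeff P.κ P.a P.lam P.u w t) ≤ δ / 2 := by
  rw [l2F_le_iff (by positivity)]
  refine (sum_norm_sq_duhamelCoeff_le_const P.hu hw P.ha P.hκ P.hlam ht F).trans ?_
  have h := P.hq
  have hκl : 0 < 2 * P.κ * P.lam := by have := P.hκ; have := P.hlam; positivity
  rw [div_le_iff₀ hκl] at h ⊢
  have hδ2 : 0 ≤ δ ^ 2 := sq_nonneg _
  calc (∑ j, (P.a j)⁻¹) * P.U ^ 2 * δ ^ 2 = ((∑ j, (P.a j)⁻¹) * P.U ^ 2) * δ ^ 2 := by ring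
    _ ≤ (1 / 4 * (2 * P.κ * P.lam)) * δ ^ 2 := mul_le_mul_of_nonneg_right h hδ2
    _ = (δ / 2) ^ 2 * (2 * P.κ * P.lam) := by ring

omit [DecidableEq d] [Nonempty d] in
/-- **The Picard map preserves the invariant ball**: for a field with `∫ w(t)² ≤ B²` on `[0,T]`,
`Φ(w)` is an admissible family with bound `B` (`A + B/2 = B`). [cite: Pazy1983, Ch. 6 §6.1 Thm. 1.2 (proof: Picard iteration), p. 184] -/
theorem isMildCoeff_mildMap {w : ℝ → UnitAddTorus d → ℝ} (hw : IsL2Field P.T (P.B ^ 2) w) :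
    IsMildCoeff P.T P.B (mildMap P.κ P.a P.lam P.u P.θ₀ w) := by
  refine ⟨fun k => continuousOn_mildMap P.hu hw P.θ₀ k, fun t ht F => ?_,
    fun t _ k => mildMap_neg P.κ P.a P.lam P.u P.θ₀ w t k⟩
  have h1 := P.l2F_heat_le ht.1 F
  have h2 := P.l2F_duhamel_le P.B_nonneg hw ht F
  have h := l2F_sub_le F (fun k => ((Real.exp (-((diagRate P.κ P.a k + P.lam) * t)) : ℝ) : ℂ) *
      mFourierCoeff (fun x => (P.θ₀ x : ℂ)) k) (duhamelCoeff P.κ P.a P.lam P.u w t)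
  have e : (fun k => ((Real.exp (-((diagRate P.κ P.a k + P.lam) * t)) : ℝ) : ℂ) *
      mFourierCoeff (fun x => (P.θ₀ x : ℂ)) k - duhamelCoeff P.κ P.a P.lam P.u w t k) =
      mildMap P.κ P.a P.lam P.u P.θ₀ w t := by
    funext k; rw [mildMap_apply]
  rw [e] at h
  calc l2F F (mildMap P.κ P.a P.lam P.u P.θ₀ w t) ≤ P.A + P.B / 2 := h.trans (add_le_add h1 h2)
    _ = P.B := by rw [B]; ring

omit [DecidableEq d] [Nonempty d] in
/-- The zeroth iterate `Φ(0)` (the damped heat flow of the datum) is admissible. [cite: Pazy1983, Ch. 6 §6.1 Thm. 1.2 (proof: Picard iteration), p. 184] -/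
theorem isMildCoeff_zero : IsMildCoeff P.T P.B (mildMap P.κ P.a P.lam P.u P.θ₀ fun _ _ => (0 : ℝ)) :=
  P.isMildCoeff_mildMap (IsL2Field.zero P.T (sq_nonneg _))

/-- **An iterate**: an admissible coefficient family with the invariant bound. [cite: Pazy1983, Ch. 6 §6.1 Thm. 1.2 (proof: Picard iteration), p. 184] -/
structure Iterate where
  /-- the coefficient family -/
  c : ℝ → (d → ℤ) → ℂ
  /-- admissibility -/
  hc : IsMildCoeff P.T P.B c

namespace Iterate

variable {P}
variable (I : P.Iterate)

/-- The synthesized field of an iterate (a choice). [cite: RobinsonRodrigoSadowski2016, Thm. 4.11] -/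
def field : ℝ → UnitAddTorus d → ℝ := Classical.choose (I.hc.exists_field P.hT.le)

/-- The synthesized field is an `L^∞_t L²_x` field with the invariant bound. [cite: RobinsonRodrigoSadowski2016, Thm. 4.11] -/
theorem isL2Field_field : IsL2Field P.T (P.B ^ 2) I.field :=
  (Classical.choose_spec (I.hc.exists_field P.hT.le)).1

/-- The synthesized field has the prescribed Fourier coefficients on `[0,T]`. [cite: RobinsonRodrigoSadowski2016, Thm. 4.11] -/
theorem mFourierCoeff_field {t : ℝ} (ht : t ∈ Icc 0 P.T) (k : d → ℤ) :
    mFourierCoeff (fun x => (I.field t x : ℂ)) k = I.c t k :=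
  (Classical.choose_spec (I.hc.exists_field P.hT.le)).2 t ht k

/-- **The Picard step** `I ↦ Φ(field I)`. [cite: Pazy1983, Ch. 6 §6.1 Thm. 1.2 (proof: Picard iteration), p. 184] -/
def next : P.Iterate :=
  ⟨mildMap P.κ P.a P.lam P.u P.θ₀ I.field, P.isMildCoeff_mildMap I.isL2Field_field⟩

end Iterate

/-- **The Picard iterates** `c₀ = Φ(0)`, `cₙ₊₁ = Φ(wₙ)` with `wₙ` the synthesized field of `cₙ`. [cite: Pazy1983, Ch. 6 §6.1 Thm. 1.2 (proof: Picard iteration), p. 184] -/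
def iter : ℕ → P.Iterate
  | 0 => ⟨_, P.isMildCoeff_zero⟩
  | n + 1 => (iter n).next

/-- Unfolding the zeroth iterate. [cite: Pazy1983, Ch. 6 §6.1 Thm. 1.2 (proof: Picard iteration), p. 184] -/
theorem iter_zero_c : (P.iter 0).c = mildMap P.κ P.a P.lam P.u P.θ₀ fun _ _ => (0 : ℝ) := rfl

/-- **Geometric decay of consecutive differences**:
`l2F F (cₙ₊₁(t) - cₙ(t)) ≤ B (1/2)^{n+1}` on `[0,T]`. [cite: Pazy1983, Ch. 6 §6.1 Thm. 1.2 (proof: Picard iteration), p. 184] -/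
theorem l2F_iter_succ_sub_le (n : ℕ) {t : ℝ} (ht : t ∈ Icc 0 P.T) (F : Finset (d → ℤ)) :
    l2F F (fun k => (P.iter (n + 1)).c t k - (P.iter n).c t k) ≤ P.B * (1 / 2) ^ (n + 1) := by
  induction n generalizing t F with
  | zero =>
    -- `c₁ - c₀ = -(D(w₀) - D(0)) = -D(w₀)`
    have hw₀ := (P.iter 0).isL2Field_field
    have e : (fun k => (P.iter 1).c t k - (P.iter 0).c t k) =
        fun k => -(duhamelCoeff P.κ P.a P.lam P.u (P.iter 0).field t k) := by
      funext k
      have hc1 : (P.iter 1).c = mildMap P.κ P.a P.lam P.u P.θ₀ (P.iter 0).field := rfl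
      rw [hc1, iter_zero_c, mildMap_apply, mildMap_apply, duhamelCoeff_zero_field]
      simp
    rw [e]
    have e2 : l2F F (fun k => -duhamelCoeff P.κ P.a P.lam P.u (P.iter 0).field t k) =
        l2F F (duhamelCoeff P.κ P.a P.lam P.u (P.iter 0).field t) := by
      simp only [l2F_apply, norm_neg]
    rw [e2, zero_add, pow_one, mul_one_div]
    exact P.l2F_duhamel_le P.B_nonneg hw₀ ht F
  | succ n ih =>
    -- `cₙ₊₂ - cₙ₊₁ = -(D(wₙ₊₁) - D(wₙ)) = -D(wₙ₊₁ - wₙ)`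
    have hδ : 0 ≤ P.B * (1 / 2) ^ (n + 1) := by have := P.B_nonneg; positivity
    have hdiff : IsL2Field P.T ((P.B * (1 / 2) ^ (n + 1)) ^ 2)
        (fun s x => (P.iter (n + 1)).field s x - (P.iter n).field s x) :=
      (P.iter (n + 1)).isL2Field_field.sub_of_coeff (P.iter n).isL2Field_field
        (fun s hs k => (P.iter (n + 1)).mFourierCoeff_field hs k)
        (fun s hs k => (P.iter n).mFourierCoeff_field hs k) hδ (fun s hs G => ih hs G)
    have e : (fun k => (P.iter (n + 1 + 1)).c t k - (P.iter (n + 1)).c t k) =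
        fun k => -(duhamelCoeff P.κ P.a P.lam P.u
          (fun s x => (P.iter (n + 1)).field s x - (P.iter n).field s x) t k) := by
      funext k
      have hc1 : (P.iter (n + 1 + 1)).c = mildMap P.κ P.a P.lam P.u P.θ₀ (P.iter (n + 1)).field := rfl
      have hc0 : (P.iter (n + 1)).c = mildMap P.κ P.a P.lam P.u P.θ₀ (P.iter n).field := rfl
      rw [hc1, hc0, mildMap_apply, mildMap_apply,
        duhamelCoeff_sub P.hu (P.iter (n + 1)).isL2Field_field (P.iter n).isL2Field_field ht.2]
      ring
    rw [e]
    have e2 : l2F F (fun k => -duhamelCoeff P.κ P.a P.lam P.u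
          (fun s x => (P.iter (n + 1)).field s x - (P.iter n).field s x) t k) =
        l2F F (duhamelCoeff P.κ P.a P.lam P.u
          (fun s x => (P.iter (n + 1)).field s x - (P.iter n).field s x) t) := by
      simp only [l2F_apply, norm_neg]
    rw [e2]
    calc l2F F (duhamelCoeff P.κ P.a P.lam P.u
          (fun s x => (P.iter (n + 1)).field s x - (P.iter n).field s x) t)
        ≤ P.B * (1 / 2) ^ (n + 1) / 2 := P.l2F_duhamel_le hδ hdiff ht F
      _ = P.B * (1 / 2) ^ (n + 1 + 1) := by ring

/-- **The iterates are Cauchy, uniformly on `[0,T]` and in the frequency set**: for `n ≤ m`,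
`l2F F (cₘ(t) - cₙ(t)) ≤ B (1/2)^n - B (1/2)^m ≤ B (1/2)^n`. [cite: Pazy1983, Ch. 6 §6.1 Thm. 1.2 (proof: Picard iteration), p. 184] -/
theorem l2F_iter_sub_le {n m : ℕ} (hnm : n ≤ m) {t : ℝ} (ht : t ∈ Icc 0 P.T) (F : Finset (d → ℤ)) :
    l2F F (fun k => (P.iter m).c t k - (P.iter n).c t k) ≤ P.B * (1 / 2) ^ n - P.B * (1 / 2) ^ m := by
  induction m, hnm using Nat.le_induction with
  | base =>
    have : l2F F (fun k => (P.iter n).c t k - (P.iter n).c t k) = 0 := by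
      simp [l2F_apply]
    rw [this, sub_self]
  | succ m hnm ih =>
    have h1 := P.l2F_iter_succ_sub_le m ht F
    calc l2F F (fun k => (P.iter (m + 1)).c t k - (P.iter n).c t k)
        ≤ P.B * (1 / 2) ^ (m + 1) + (P.B * (1 / 2) ^ n - P.B * (1 / 2) ^ m) := l2F_sub_le_of_le h1 ih
      _ = P.B * (1 / 2) ^ n - P.B * (1 / 2) ^ (m + 1) := by ring

/-- Coordinatewise Cauchy bound: `‖cₘ(t)(k) - cₙ(t)(k)‖ ≤ B (1/2)^n` for `n ≤ m`, `t ∈ [0,T]`. [cite: Pazy1983, Ch. 6 §6.1 Thm. 1.2 (proof: Picard iteration), p. 184] -/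
theorem norm_iter_sub_le {n m : ℕ} (hnm : n ≤ m) {t : ℝ} (ht : t ∈ Icc 0 P.T) (k : d → ℤ) :
    ‖(P.iter m).c t k - (P.iter n).c t k‖ ≤ P.B * (1 / 2) ^ n := by
  have h := P.l2F_iter_sub_le hnm ht {k}
  have h0 : 0 ≤ P.B * (1 / 2) ^ m := by have := P.B_nonneg; positivity
  exact (norm_le_l2F (Finset.mem_singleton_self k) (fun k => (P.iter m).c t k - (P.iter n).c t k)).trans
    (h.trans (by linarith))

omit [DecidableEq d] [Nonempty d] in
/-- A geometric threshold: `B (1/2)^N < ε` for some `N`. [cite: Pazy1983, Ch. 6 §6.1 Thm. 1.2 (proof: Picard iteration), p. 184] -/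
theorem exists_pow_lt {ε : ℝ} (hε : 0 < ε) : ∃ N : ℕ, P.B * (1 / 2) ^ N < ε := by
  have h := (tendsto_pow_atTop_nhds_zero_of_lt_one (by norm_num : (0 : ℝ) ≤ 1 / 2)
    (by norm_num : (1 : ℝ) / 2 < 1)).const_mul P.B
  rw [mul_zero] at h
  exact (h.eventually (gt_mem_nhds hε)).exists

/-- **The iterates converge coordinatewise** on `[0,T]` (Cauchy in `ℂ`). [cite: Pazy1983, Ch. 6 §6.1 Thm. 1.2 (proof: Picard iteration), p. 184] -/
theorem cauchySeq_iter {t : ℝ} (ht : t ∈ Icc 0 P.T) (k : d → ℤ) : CauchySeq fun n => (P.iter n).c t k := by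
  refine Metric.cauchySeq_iff'.2 fun ε hε => ?_
  obtain ⟨N, hN⟩ := P.exists_pow_lt hε
  refine ⟨N, fun n hn => ?_⟩
  rw [dist_eq_norm]
  exact (P.norm_iter_sub_le hn ht k).trans_lt hN

/-- **The limit family** `c_∞(t)(k) = limₙ cₙ(t)(k)` (meaningful for `t ∈ [0,T]`). [cite: Pazy1983, Ch. 6 §6.1 Thm. 1.2 (proof: Picard iteration), p. 184] -/
def limCoeff : ℝ → (d → ℤ) → ℂ := fun t k => limUnder atTop fun n => (P.iter n).c t k

/-- The iterates converge to the limit family on `[0,T]`. [cite: Pazy1983, Ch. 6 §6.1 Thm. 1.2 (proof: Picard iteration), p. 184] -/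
theorem tendsto_limCoeff {t : ℝ} (ht : t ∈ Icc 0 P.T) (k : d → ℤ) :
    Tendsto (fun n => (P.iter n).c t k) atTop (𝓝 (P.limCoeff t k)) :=
  tendsto_nhds_limUnder (cauchySeq_tendsto_of_complete (P.cauchySeq_iter ht k))

/-- **Rate of convergence in the finite `ℓ²` norms**: `l2F F (c_∞(t) - cₙ(t)) ≤ B (1/2)^n`,
uniformly in `t ∈ [0,T]` and `F`. [cite: Pazy1983, Ch. 6 §6.1 Thm. 1.2 (proof: Picard iteration), p. 184] -/
theorem l2F_limCoeff_sub_le (n : ℕ) {t : ℝ} (ht : t ∈ Icc 0 P.T) (F : Finset (d → ℤ)) :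
    l2F F (fun k => P.limCoeff t k - (P.iter n).c t k) ≤ P.B * (1 / 2) ^ n := by
  have h : Tendsto (fun m => l2F F fun k => (P.iter m).c t k - (P.iter n).c t k) atTop
      (𝓝 (l2F F fun k => P.limCoeff t k - (P.iter n).c t k)) := by
    simp only [l2F_apply]
    refine (Real.continuous_sqrt.tendsto _).comp (tendsto_finsetSum _ fun k _ => ?_)
    exact (((P.tendsto_limCoeff ht k).sub tendsto_const_nhds).norm).pow 2
  refine le_of_tendsto h (eventually_atTop.2 ⟨n, fun m hm => ?_⟩)
  have h0 : 0 ≤ P.B * (1 / 2) ^ m := by have := P.B_nonneg; positivity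
  linarith [P.l2F_iter_sub_le hm ht F]

/-- The limit family obeys the invariant bound: `l2F F (c_∞(t)) ≤ B` on `[0,T]`. [cite: Pazy1983, Ch. 6 §6.1 Thm. 1.2 (proof: Picard iteration), p. 184] -/
theorem l2F_limCoeff_le {t : ℝ} (ht : t ∈ Icc 0 P.T) (F : Finset (d → ℤ)) : l2F F (P.limCoeff t) ≤ P.B := by
  have h : Tendsto (fun m => l2F F ((P.iter m).c t)) atTop (𝓝 (l2F F (P.limCoeff t))) := by
    simp only [l2F_apply]
    refine (Real.continuous_sqrt.tendsto _).comp (tendsto_finsetSum _ fun k _ => ?_)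
    exact ((P.tendsto_limCoeff ht k).norm).pow 2
  exact le_of_tendsto' h fun m => (P.iter m).hc.l2F_le t ht F

/-- The limit family is conjugate symmetric on `[0,T]`. [cite: Grafakos2014, Prop. 3.2.6 (4)] -/
theorem limCoeff_symm {t : ℝ} (ht : t ∈ Icc 0 P.T) (k : d → ℤ) : P.limCoeff t (-k) = conj (P.limCoeff t k) := by
  have h1 := P.tendsto_limCoeff ht (-k)
  have h2 : Tendsto (fun n => conj ((P.iter n).c t k)) atTop (𝓝 (conj (P.limCoeff t k))) :=
    (Complex.continuous_conj.tendsto _).comp (P.tendsto_limCoeff ht k)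
  exact tendsto_nhds_unique h1 (h2.congr fun n => ((P.iter n).hc.symm t ht k).symm)

/-- **The limit family is continuous in time** on `[0,T]` at every frequency (uniform limit of
continuous functions). [cite: Pazy1983, Ch. 6 §6.1 Thm. 1.2 (proof: Picard iteration), p. 184] -/
theorem continuousOn_limCoeff (k : d → ℤ) : ContinuousOn (fun t => P.limCoeff t k) (Icc 0 P.T) := by
  have hU : TendstoUniformlyOn (fun n t => (P.iter n).c t k) (fun t => P.limCoeff t k) atTop (Icc 0 P.T) := by
    refine Metric.tendstoUniformlyOn_iff.2 fun ε hε => ?_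
    obtain ⟨N, hN⟩ := P.exists_pow_lt hε
    refine eventually_atTop.2 ⟨N, fun n hn t ht => ?_⟩
    rw [dist_eq_norm]
    have h1 := norm_le_l2F (Finset.mem_singleton_self k) (fun k => P.limCoeff t k - (P.iter n).c t k)
    have h2 := P.l2F_limCoeff_sub_le n ht {k}
    have h3 : P.B * (1 / 2) ^ n ≤ P.B * (1 / 2) ^ N :=
      mul_le_mul_of_nonneg_left (pow_le_pow_of_le_one (by norm_num) (by norm_num) hn) P.B_nonneg
    exact (h1.trans (h2.trans h3)).trans_lt hN
  exact hU.continuousOn (Eventually.of_forall fun n => (P.iter n).hc.continuousOn k).frequently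

/-- The limit family is admissible with the invariant bound. [cite: Pazy1983, Ch. 6 §6.1 Thm. 1.2 (proof: Picard iteration), p. 184] -/
theorem isMildCoeff_limCoeff : IsMildCoeff P.T P.B P.limCoeff :=
  ⟨P.continuousOn_limCoeff, fun _ ht F => P.l2F_limCoeff_le ht F, fun _ ht k => P.limCoeff_symm ht k⟩

/-- The limit iterate. [cite: Pazy1983, Ch. 6 §6.1 Thm. 1.2 (proof: Picard iteration), p. 184] -/
def limIterate : P.Iterate := ⟨P.limCoeff, P.isMildCoeff_limCoeff⟩

/-- The coefficients of the limit iterate are the limit family. [cite: Pazy1983, Ch. 6 §6.1 Thm. 1.2 (proof: Picard iteration), p. 184] -/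
theorem limIterate_c : P.limIterate.c = P.limCoeff := rfl

/-- **The fixed point.** The synthesized field `w` of the limit family satisfies the damped mild
equation with itself: `𝓕(w(t))(k) = c_∞(t)(k) = e^{-(νₖ+λ)t} θ̂₀(k) - D^λ(w)(t)(k)` for all
`t ∈ [0,T]` and all `k` (`‖c_∞ - Φ(w)‖ ≤ ‖c_∞ - cₙ₊₁‖ + ‖Φ(wₙ) - Φ(w)‖ ≤ B(1/2)^{n+1} + B(1/2)^{n+1} → 0`).
[cite: Pazy1983, Ch. 6 §6.1 Thm. 1.2 (proof: Picard iteration), p. 184] -/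
theorem limCoeff_eq_mildMap {t : ℝ} (ht : t ∈ Icc 0 P.T) (k : d → ℤ) :
    P.limCoeff t k = mildMap P.κ P.a P.lam P.u P.θ₀ P.limIterate.field t k := by
  refine eq_of_norm_sub_le_zero ?_
  have hlim : Tendsto (fun n : ℕ => P.B * (1 / 2) ^ n) atTop (𝓝 0) := by
    have h := (tendsto_pow_atTop_nhds_zero_of_lt_one (by norm_num : (0 : ℝ) ≤ 1 / 2)
      (by norm_num : (1 : ℝ) / 2 < 1)).const_mul P.B
    rwa [mul_zero] at h
  refine ge_of_tendsto' hlim fun n => ?_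
  -- the field difference `wₙ - w_∞`
  have hδ : 0 ≤ P.B * (1 / 2) ^ n := by have := P.B_nonneg; positivity
  have hdiff : IsL2Field P.T ((P.B * (1 / 2) ^ n) ^ 2)
      (fun s x => (P.iter n).field s x - P.limIterate.field s x) :=
    (P.iter n).isL2Field_field.sub_of_coeff P.limIterate.isL2Field_field
      (fun s hs k => (P.iter n).mFourierCoeff_field hs k)
      (fun s hs k => P.limIterate.mFourierCoeff_field hs k) hδ (fun s hs G => by
        rw [l2F_sub_comm, limIterate_c]; exact P.l2F_limCoeff_sub_le n hs G)
  -- `cₙ₊₁ - Φ(w_∞) = -(D(wₙ) - D(w_∞)) = -D(wₙ - w_∞)`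
  have hc1 : (P.iter (n + 1)).c = mildMap P.κ P.a P.lam P.u P.θ₀ (P.iter n).field := rfl
  have e : (P.iter (n + 1)).c t k - mildMap P.κ P.a P.lam P.u P.θ₀ P.limIterate.field t k =
      -(duhamelCoeff P.κ P.a P.lam P.u (fun s x => (P.iter n).field s x - P.limIterate.field s x) t k) := by
    rw [hc1, mildMap_apply, mildMap_apply,
      duhamelCoeff_sub P.hu (P.iter n).isL2Field_field P.limIterate.isL2Field_field ht.2]
    ring
  have h2 : ‖(P.iter (n + 1)).c t k - mildMap P.κ P.a P.lam P.u P.θ₀ P.limIterate.field t k‖ ≤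
      P.B * (1 / 2) ^ n / 2 := by
    rw [e, norm_neg]
    exact (norm_le_l2F (Finset.mem_singleton_self k) _).trans (P.l2F_duhamel_le hδ hdiff ht {k})
  have h1 : ‖P.limCoeff t k - (P.iter (n + 1)).c t k‖ ≤ P.B * (1 / 2) ^ (n + 1) :=
    (norm_le_l2F (Finset.mem_singleton_self k) _).trans (P.l2F_limCoeff_sub_le (n + 1) ht {k})
  calc ‖P.limCoeff t k - mildMap P.κ P.a P.lam P.u P.θ₀ P.limIterate.field t k‖
      ≤ ‖P.limCoeff t k - (P.iter (n + 1)).c t k‖ +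
          ‖(P.iter (n + 1)).c t k - mildMap P.κ P.a P.lam P.u P.θ₀ P.limIterate.field t k‖ :=
        norm_sub_le_norm_sub_add_norm_sub _ _ _
    _ ≤ P.B * (1 / 2) ^ (n + 1) + P.B * (1 / 2) ^ n / 2 := add_le_add h1 h2
    _ = P.B * (1 / 2) ^ n := by ring

/-- **Existence of a damped mild solution** (summary of the Picard iteration): a jointly measurable
real field `w` on `(0,T) × T^d` with `∫ w(t)² ≤ B² = 4∫θ₀²` at every `t ∈ [0,T]`, whose Fourier
coefficients are continuous in `t`, conjugate symmetric, and satisfy the damped mild equation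
`𝓕(w(t))(k) = e^{-(νₖ+λ)t} θ̂₀(k) - ∫_{(0,t]} e^{-(νₖ+λ)(t-s)} N(w)(s)(k) ds` on `[0,T]`
(Pazy 1983, Ch. 4 Def. 2.3 with Ch. 6 Thm. 1.2's iteration). [cite: Pazy1983, Ch. 6 §6.1 Thm. 1.2 (proof: Picard iteration), p. 184] -/
theorem exists_dampedMildSolution :
    ∃ w : ℝ → UnitAddTorus d → ℝ, IsL2Field P.T (P.B ^ 2) w ∧
      (∀ k, ContinuousOn (fun t => mFourierCoeff (fun x => (w t x : ℂ)) k) (Icc 0 P.T)) ∧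
      ∀ t ∈ Icc 0 P.T, ∀ k,
        mFourierCoeff (fun x => (w t x : ℂ)) k = mildMap P.κ P.a P.lam P.u P.θ₀ w t k := by
  refine ⟨P.limIterate.field, P.limIterate.isL2Field_field, fun k => ?_, fun t ht k => ?_⟩
  · exact (P.continuousOn_limCoeff k).congr fun t ht => P.limIterate.mFourierCoeff_field ht k
  · rw [P.limIterate.mFourierCoeff_field ht k, limIterate_c]
    exact P.limCoeff_eq_mildMap ht k

end MildData

end Picard

end Torus

end Literature.Analysis.FluidPDE

end
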